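import Literature.Probability.RandomPlanarGeometry.LSW2004USTRado
import Literature.Probability.RandomPlanarGeometry.ConformalRectangleProofs
import Literature.Probability.RandomPlanarGeometry.JordanIndex
import HarnessLib

/-!
# The conformal modulus is continuous under uniform convergence of marked Jordan curves (Radó)

Topic `Literature/Probability/RandomPlanarGeometry` (conformal rectangles and their cross-ratio
modulus, `ConformalRectangle.lean`, `ConformalRectangleProofs.lean`); theorems only (no
definition, no named fact). The main result is

* **`ConformalRectangle.tendsto_crossRatio_of_tendstoUniformly`** — if the boundary loops of the
  conformal rectangles `Q_n` converge uniformly (as parametrised loops) to that of `R`, and the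
  four marked points converge, `Q_n.pt i → R.pt i`, then for ANY uniformizing data `(ψ_n, y_n)` of
  `Q_n` and `(φ, x)` of `R` the Cardy cross-ratios converge: `crossRatio (y n) → crossRatio x`;
* `ConformalRectangle.tendsto_crossRatio_of_tendsto_mark` — the same with the hypothesis on the
  marked points replaced by convergence of the mark parameters `Q_n.mark i → R.mark i`.

This is the continuity of the conformal modulus of a quadrilateral in the topology of uniform
convergence of the boundary parametrisation, a corollary of **Radó's theorem** (T. Radó 1923;
Ch. Pommerenke, *Boundary Behaviour of Conformal Maps* (1992), §2.3 Thm. 2.11 with Cor. 2.4),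
PROVED in the tree as `JordanDomain.rado_tendstoUniformlyOn_holds` (`RadoConvergenceProofs.lean`;
closed-disc form `JordanDomain.rado_tendstoUniformlyOn.closedBall`).

Proof. (1) *Interior points are stable* (`JordanDomain.mem_carrier_of_dist_boundary_lt`,
`JordanDomain.eventually_mem_carrier_of_tendstoUniformly`; dog-on-leash): a point `z₀ ∈ R` lies in
`Q_n` as soon as `‖Q_n.boundary - R.boundary‖_∞ < dist (z₀, ∂R)`, since then the two boundary
loops have the same winding number about `z₀` (`wind_eq_of_norm_sub_lt`), which is `≠ 0`
(`JordanDomain.index_ne_zero_of_mem_carrier`) whereas exterior points have index `0`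
(`JordanDomain.index_eq_zero_of_mem_exterior`). (2) *The modulus read off a disc chart*
(`ConformalRectangle.ofReal_crossRatio_eq_cCrossRatio`): if `f : 𝔻 → R` is conformal with an
injective continuous (Carathéodory) extension `Φ` to `𝔻̄` and `Φ ζ_i = R.pt i`, then
`crossRatio x = cCrossRatio ζ` for every uniformizing datum `(φ, x)`: the conformal map
`S = f⁻¹ ∘ φ : ℍ → 𝔻` is the Möbius map `z ↦ μ (z - w)/(z - w̄)`
(`ConformalEquiv.exists_eqOn_mul_moebius`), it tends to `ζ_i` at `x_i`
(`tendsto_of_injOn_of_tendsto_comp`), so `ζ_i` is the Möbius image of `x_i`, and Möbius maps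
preserve the cross-ratio (`cCrossRatio_moebius`). (3) *Radó*: normalise Riemann maps
`f_n : 𝔻 → Q_n`, `f : 𝔻 → R` at a common interior point `z₀` (for the tail of the sequence, by (1));
their Carathéodory extensions converge uniformly on `𝔻̄`, hence the circle preimages of the
corners converge, `ζ_{n,i} → ζ_i` (injectivity of `Φ` on the compact `𝔻̄`), the `ζ_i` are pairwise
distinct, and `cCrossRatio ζ_n → cCrossRatio ζ`; by (2) these are the cross-ratios of the given
uniformizing data.

## Mathlib / tree

Mathlib: `TendstoUniformly`, `Metric.tendstoUniformlyOn_iff`, `Filter.Tendsto.congr_dist`,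
`Filter.tendsto_add_atTop_iff_nat`. Tree: `JordanDomain.rado_tendstoUniformlyOn_holds`,
`JordanDomain.exists_continuousOn_extension_holds` (Carathéodory),
`exists_conformalEquiv_ball_deriv_pos` (normalised Riemann maps),
`ConformalEquiv.exists_eqOn_mul_moebius`, `cCrossRatio_moebius`,
`JordanDomain.index` (`JordanIndex.lean`), `wind_eq_of_norm_sub_lt` (`WindingNumber.lean`).
Searched (`lean search`): `tendsto_crossRatio`, `crossRatio_continuous`, `eventually_mem_carrier` —
no prior statement of modulus continuity in the tree (`RadoContinuity.lean` concerns laws of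
curves, `ChordalUniformizerConvergence.lean` the two-point (chordal) normalisation).

## References

* Ch. Pommerenke, *Boundary Behaviour of Conformal Maps*, Grundlehren 299, Springer (1992), §2.3
  Thm. 2.11 (Radó), Cor. 2.4, Thm. 2.6 (Carathéodory), §2.3 Exercise 2 (the modulus of a
  quadrilateral). [`PommerenkeBBCM1992`]
* T. Radó, *Sur la représentation conforme de domaines variables*, Acta Sci. Math. (Szeged) 1
  (1923), 180–186.
* L. V. Ahlfors, *Complex Analysis*, 3rd ed. (1979), Ch. 3 §3.1 (cross-ratio), Ch. 4 §2.1
  (winding number). [`AhlforsCA1979`]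
-/

noncomputable section

open Set Function Filter Metric Complex
open _root_.Topology
open UpperHalfPlane (upperHalfPlaneSet)
open scoped ComplexConjugate

namespace Literature.Probability.RandomPlanarGeometry

/-! ### Interior points are stable under uniform perturbation of the boundary loop -/

namespace JordanDomain

/-- **Dog-on-leash for Jordan domains: the index.** If the boundary loop of `D'` is pointwise
closer to that of `D` than the distance from `z₀ ∈ D` to `∂D`, the two loops have the same
winding number about `z₀` (Rouché's principle for loops, `wind_eq_of_norm_sub_lt`).
Ahlfors (1979), Ch. 4 §2.1. [folklore] -/
theorem index_eq_index_of_dist_boundary_lt (D D' : JordanDomain) {z₀ : ℂ} (hz₀ : z₀ ∈ D.carrier)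
    (hclose : ∀ t, dist (D'.boundary t) (D.boundary t) < infDist z₀ (frontier D.carrier)) :
    D'.index z₀ = D.index z₀ := by
  have hD'1 : D'.boundary 0 = D'.boundary 1 := by
    have := D'.periodic_boundary 0; rw [zero_add] at this; exact this.symm
  have hD1 : D.boundary 0 = D.boundary 1 := by
    have := D.periodic_boundary 0; rw [zero_add] at this; exact this.symm
  refine Literature.Topology.PlaneTopology.wind_eq_of_norm_sub_lt
    ((D'.continuous_boundary.sub continuous_const).continuousOn) (by rw [hD'1])
    ⟨(D.continuous_boundary.sub continuous_const).continuousOn, fun t _ ↦ ?_, by rw [hD1]⟩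
    fun t _ ↦ ?_
  · exact sub_ne_zero.2 fun h0 ↦ Set.disjoint_left.1 D.disjoint_carrier_frontier hz₀
      (by rw [← h0]; exact D.boundary_mem_frontier t)
  · rw [sub_sub_sub_cancel_right, ← dist_eq_norm, ← dist_eq_norm, dist_comm (D.boundary t) z₀]
    exact (hclose t).trans_le (infDist_le_dist_of_mem (D.boundary_mem_frontier t))

/-- **Dog-on-leash for Jordan domains: interior points.** If the boundary loop of `D'` is
pointwise closer to that of `D` than the distance from `z₀ ∈ D` to `∂D`, then `z₀ ∈ D'`: the
index of `∂D'` about `z₀` is that of `∂D` (`index_eq_index_of_dist_boundary_lt`), hence nonzero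
(`index_ne_zero_of_mem_carrier`), so `z₀` is not exterior to `D'` (`index_eq_zero_of_mem_exterior`),
and it is not on `∂D'` either, each point of which is within the leash of a point of `∂D`.
Ahlfors (1979), Ch. 4 §2.1. [folklore] -/
theorem mem_carrier_of_dist_boundary_lt (D D' : JordanDomain) {z₀ : ℂ} (hz₀ : z₀ ∈ D.carrier)
    (hclose : ∀ t, dist (D'.boundary t) (D.boundary t) < infDist z₀ (frontier D.carrier)) :
    z₀ ∈ D'.carrier := by
  have hne : D'.index z₀ ≠ 0 := by
    rw [index_eq_index_of_dist_boundary_lt D D' hz₀ hclose]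
    exact D.index_ne_zero_of_mem_carrier hz₀
  have hcl : z₀ ∈ closure D'.carrier := by
    by_contra hout
    exact hne (D'.index_eq_zero_of_mem_exterior hout)
  rw [closure_eq_self_union_frontier] at hcl
  rcases hcl with h | h
  · exact h
  · exfalso
    rw [← D'.range_boundary] at h
    obtain ⟨t, ht⟩ := h
    have h1 : infDist z₀ (frontier D.carrier) ≤ dist (D'.boundary t) (D.boundary t) := by
      rw [ht]
      exact infDist_le_dist_of_mem (D.boundary_mem_frontier t)
    exact absurd (hclose t) (not_lt.2 h1)

variable {D : ℕ → JordanDomain} {Dlim : JordanDomain}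

/-- **Interior points of the limit domain are eventually interior.** If the boundary loops of
`D n` converge uniformly to that of `Dlim`, every `z₀ ∈ Dlim` lies in `D n` for all large `n`
(`mem_carrier_of_dist_boundary_lt` with the leash `dist (z₀, ∂Dlim) > 0`,
`infDist_frontier_pos`). Pommerenke (1992), §1.4 (kernel convergence). [folklore] -/
theorem eventually_mem_carrier_of_tendstoUniformly
    (hJ : TendstoUniformly (fun n ↦ (D n).boundary) Dlim.boundary atTop) {z₀ : ℂ}
    (hz₀ : z₀ ∈ Dlim.carrier) : ∀ᶠ n in atTop, z₀ ∈ (D n).carrier := by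
  filter_upwards [eventually_forall_dist_boundary_lt hJ (Dlim.infDist_frontier_pos hz₀)] with n hn
  exact mem_carrier_of_dist_boundary_lt Dlim (D n) hz₀ hn

end JordanDomain

/-! ### Marked points converge -/

namespace MarkedDomain

variable {k : ℕ} {Q : ℕ → MarkedDomain k} {R : MarkedDomain k}

/-- If the boundary loops converge uniformly and the `i`-th mark parameters converge, the `i`-th
marked points converge: `Q_n.pt i = Q_n.boundary (Q_n.mark i)` is uniformly close to
`R.boundary (Q_n.mark i) → R.boundary (R.mark i)`. [folklore] -/
theorem tendsto_pt_of_tendstoUniformly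
    (hJ : TendstoUniformly (fun n ↦ (Q n).boundary) R.boundary atTop) {i : Fin k}
    (hm : Tendsto (fun n ↦ (Q n).mark i) atTop (𝓝 (R.mark i))) :
    Tendsto (fun n ↦ (Q n).pt i) atTop (𝓝 (R.pt i)) := by
  have h1 : Tendsto (fun n ↦ R.boundary ((Q n).mark i)) atTop (𝓝 (R.pt i)) :=
    (R.continuous_boundary.tendsto _).comp hm
  refine h1.congr_dist ?_
  rw [Metric.tendsto_nhds]
  intro ε hε
  filter_upwards [Metric.tendstoUniformly_iff.1 hJ ε hε] with n hn
  rw [Real.dist_eq, sub_zero, abs_of_nonneg dist_nonneg]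
  exact hn _

end MarkedDomain

/-! ### The modulus read off a disc chart -/

namespace ConformalRectangle

/-- **The conformal modulus read off a disc chart.** Let `f : 𝔻 → R` be a conformal equivalence
onto the conformal rectangle `R`, `Φ` a continuous injective extension of `f` to the closed disc
(Carathéodory, `JordanDomain.exists_continuousOn_extension_holds`) and `ζ_i ∈ 𝔻̄` the preimages
of the marked points, `Φ ζ_i = R.pt i`. Then for EVERY uniformizing datum `(φ, x)` of `R`,
Cardy's cross-ratio `crossRatio x` is the complex cross-ratio of `(ζ₀, ζ₁, ζ₂, ζ₃)`. Indeed
`S = f⁻¹ ∘ φ : ℍ → 𝔻` is a Möbius map `z ↦ μ (z - w)/(z - w̄)` (`w = φ⁻¹ (f 0)`,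
`ConformalEquiv.exists_eqOn_mul_moebius`) with boundary value `ζ_i` at `x_i`, and the cross-ratio
is Möbius invariant (`cCrossRatio_moebius`). Ahlfors (1979), Ch. 3 §3.1; Pommerenke (1992), §2.3
Exercise 2. [cite: AhlforsCA1979, Ch. 3 §3.1] -/
theorem ofReal_crossRatio_eq_cCrossRatio (R : ConformalRectangle)
    (f : ConformalEquiv (ball (0 : ℂ) 1) R.carrier) {Φ : ℂ → ℂ}
    (hΦc : ContinuousOn Φ (closedBall 0 1)) (hΦeq : EqOn Φ f (ball 0 1))
    (hinj : InjOn Φ (closedBall 0 1)) {ζ : Fin 4 → ℂ} (hζ : ∀ i, ζ i ∈ closedBall (0 : ℂ) 1)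
    (hΦζ : ∀ i, Φ (ζ i) = R.pt i) {φ : ConformalEquiv upperHalfPlaneSet R.carrier}
    {x : Fin 4 → ℝ} (hφ : R.IsUniformizing φ x) :
    (crossRatio x : ℂ) = cCrossRatio ζ := by
  -- the conformal map `S = f⁻¹ ∘ φ : ℍ → 𝔻` and its zero `w = φ⁻¹ (f 0)`
  set S : ConformalEquiv upperHalfPlaneSet (ball (0 : ℂ) 1) := φ.trans f.symm with hS
  have h0 : (0 : ℂ) ∈ ball (0 : ℂ) 1 := mem_ball_self one_pos
  have hf0 : f 0 ∈ R.carrier := f.mapsTo h0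
  set w : ℂ := φ.symm (f 0) with hw
  have hwmem : w ∈ upperHalfPlaneSet := φ.symm_mapsTo hf0
  have hwim : 0 < w.im := hwmem
  have hSw : S w = 0 := by
    rw [hS, ConformalEquiv.trans_apply, hw, φ.apply_symm_apply hf0, f.symm_apply_apply h0]
  obtain ⟨μ, hμ1, hSμ⟩ := S.exists_eqOn_mul_moebius hwmem hSw
  have hden : ∀ i, (x i : ℂ) - conj w ≠ 0 := fun i ↦
    HalfPlanePick.sub_conj_ne_zero hwim (by simp)
  have hx1 : ∀ i, 1 * (x i : ℂ) + -conj w ≠ 0 := fun i ↦ by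
    rw [one_mul, ← sub_eq_add_neg]; exact hden i
  -- boundary values: `S → ζ i` at `x i` (Carathéodory extension, injective on the compact disc)
  have hlim : ∀ i, Tendsto S (𝓝[upperHalfPlaneSet] (x i : ℂ)) (𝓝 (ζ i)) := fun i ↦ by
    have h1 : Tendsto φ (𝓝[upperHalfPlaneSet] (x i : ℂ)) (𝓝[R.carrier] (R.pt i)) :=
      tendsto_nhdsWithin_iff.2 ⟨hφ.2 i, eventually_nhdsWithin_of_forall fun z hz ↦ φ.mapsTo hz⟩
    have h2 : Tendsto f.symm (𝓝[R.carrier] (R.pt i)) (𝓝 (ζ i)) := by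
      rw [← hΦζ i]
      have hg : ∀ᶠ q in 𝓝[R.carrier] (Φ (ζ i)), f.symm q ∈ closedBall (0 : ℂ) 1 := by
        filter_upwards [self_mem_nhdsWithin] with q hq
        exact ball_subset_closedBall (f.symm_mapsTo hq)
      refine tendsto_of_injOn_of_tendsto_comp (isCompact_closedBall 0 1) hΦc hinj hg (hζ i) ?_
      have hev : (Φ ∘ f.symm) =ᶠ[𝓝[R.carrier] (Φ (ζ i))] id := by
        filter_upwards [self_mem_nhdsWithin] with q hq
        simp only [Function.comp_apply, id]
        rw [hΦeq (f.symm_mapsTo hq), f.apply_symm_apply hq]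
      exact (tendsto_id.mono_left nhdsWithin_le_nhds).congr' hev.symm
    exact h2.comp h1
  -- and `S → μ (x i - w)/(x i - w̄)` at `x i`, by continuity of the Möbius map
  have hlim' : ∀ i, Tendsto S (𝓝[upperHalfPlaneSet] (x i : ℂ))
      (𝓝 (μ * (((x i : ℂ) - w) / ((x i : ℂ) - conj w)))) := fun i ↦ by
    have hcont : ContinuousAt (fun z : ℂ ↦ μ * ((z - w) / (z - conj w))) (x i : ℂ) :=
      continuousAt_const.mul
        ((continuousAt_id.sub continuousAt_const).div (continuousAt_id.sub continuousAt_const)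
          (hden i))
    exact (hcont.tendsto.mono_left nhdsWithin_le_nhds).congr'
      (eventually_nhdsWithin_of_forall fun z hz ↦ (hSμ hz).symm)
  -- so `ζ i` is the Möbius image of `x i`
  have hζeq : ∀ i, ζ i = (μ * (x i : ℂ) + -(μ * w)) / (1 * (x i : ℂ) + -conj w) := fun i ↦ by
    haveI : NeBot (𝓝[upperHalfPlaneSet] (x i : ℂ)) :=
      mem_closure_iff_nhdsWithin_neBot.1 (mem_closure_upperHalfPlaneSet_iff.2 (by simp))
    rw [tendsto_nhds_unique (hlim i) (hlim' i), mul_div_assoc',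
      div_eq_div_iff (hden i) (hx1 i)]
    ring
  -- Möbius invariance of the cross-ratio
  have hdet : μ * -conj w - -(μ * w) * 1 ≠ 0 := by
    have hμ0 : μ ≠ 0 := norm_ne_zero_iff.1 (by rw [hμ1]; exact one_ne_zero)
    have : μ * -conj w - -(μ * w) * 1 = μ * (w - conj w) := by ring
    rw [this]
    exact mul_ne_zero hμ0 (HalfPlanePick.self_sub_conj_ne_zero hwim.ne')
  calc (crossRatio x : ℂ) = cCrossRatio (fun i ↦ (x i : ℂ)) := (cCrossRatio_ofReal x).symm
    _ = cCrossRatio (fun i ↦ (μ * (x i : ℂ) + -(μ * w)) / (1 * (x i : ℂ) + -conj w)) :=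
        (cCrossRatio_moebius _ hdet hx1).symm
    _ = cCrossRatio ζ := by
        congr 1
        funext i
        exact (hζeq i).symm

/-! ### Radó: the cross-ratio is continuous along uniformly convergent marked loops -/

variable {Q : ℕ → ConformalRectangle} {R : ConformalRectangle}

/-- **Continuity of the modulus, normalised form.** If the boundary loops of `Q n` converge
uniformly to that of `R`, the marked points converge, and `z₀ ∈ R` lies in every `Q n`, then the
cross-ratios of arbitrary uniformizing data converge. Radó's theorem
(`JordanDomain.rado_tendstoUniformlyOn_holds`, closed-disc form) for the Riemann maps normalised
at `z₀` makes the Carathéodory extensions converge uniformly on `𝔻̄`; the circle preimages of the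
corners converge by injectivity of the limit extension on the compact closed disc
(`tendsto_of_injOn_of_tendsto_comp`), and the cross-ratios are read off these preimages
(`ofReal_crossRatio_eq_cCrossRatio`). Pommerenke (1992), §2.3, Thm. 2.11 and Cor. 2.4.
[cite: PommerenkeBBCM1992, Thm. 2.11] -/
theorem tendsto_crossRatio_of_tendstoUniformly_of_mem
    (hJ : TendstoUniformly (fun n ↦ (Q n).boundary) R.boundary atTop)
    (hpt : ∀ i, Tendsto (fun n ↦ (Q n).pt i) atTop (𝓝 (R.pt i)))
    {z₀ : ℂ} (hz₀ : z₀ ∈ R.carrier) (hz₀n : ∀ n, z₀ ∈ (Q n).carrier)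
    {ψ : ∀ n, ConformalEquiv upperHalfPlaneSet (Q n).carrier} {y : ℕ → Fin 4 → ℝ}
    (hψ : ∀ n, (Q n).IsUniformizing (ψ n) (y n))
    {φ : ConformalEquiv upperHalfPlaneSet R.carrier} {x : Fin 4 → ℝ} (hφ : R.IsUniformizing φ x) :
    Tendsto (fun n ↦ crossRatio (y n)) atTop (𝓝 (crossRatio x)) := by
  classical
  -- normalised Riemann maps `f n : 𝔻 → Q n`, `fl : 𝔻 → R` at `z₀`
  obtain ⟨gl, hgl0, hglre, hglim⟩ := exists_conformalEquiv_ball_deriv_pos R.isOpen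
    (JordanDomain.isSimplyConnected_holds R.toJordanDomain) R.carrier_ne_univ hz₀
  choose g hg0 hgre hgim using fun n ↦ exists_conformalEquiv_ball_deriv_pos (Q n).isOpen
    (JordanDomain.isSimplyConnected_holds (Q n).toJordanDomain) (Q n).carrier_ne_univ (hz₀n n)
  set f : ∀ n, ConformalEquiv (ball (0 : ℂ) 1) (Q n).carrier := fun n ↦ (g n).symm with hf
  set fl : ConformalEquiv (ball (0 : ℂ) 1) R.carrier := gl.symm with hfl
  have hfl0 : fl 0 = z₀ := by
    have := gl.symm_apply_apply hz₀
    rwa [hgl0] at this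
  have hf0' : ∀ n, f n 0 = z₀ := fun n ↦ by
    have := (g n).symm_apply_apply (hz₀n n)
    rwa [hg0 n] at this
  have hf0 : ∀ n, f n 0 = fl 0 := fun n ↦ by rw [hf0' n, hfl0]
  have hfd : ∀ n, 0 < (deriv (f n) 0).re ∧ (deriv (f n) 0).im = 0 := fun n ↦ by
    have h := (g n).deriv_symm_mul_deriv (Q n).isOpen (hz₀n n)
    rw [hg0 n] at h
    exact Rado.re_pos_im_zero_of_mul_eq_one (hgre n) (hgim n) h
  have hfld : 0 < (deriv fl 0).re ∧ (deriv fl 0).im = 0 := by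
    have h := gl.deriv_symm_mul_deriv R.isOpen hz₀
    rw [hgl0] at h
    exact Rado.re_pos_im_zero_of_mul_eq_one hglre hglim h
  -- Carathéodory extensions and Radó's theorem on the closed disc
  choose Φ hΦc hΦeq hΦbij hΦsph using
    fun n ↦ JordanDomain.exists_continuousOn_extension_holds (Q n).toJordanDomain (f n)
  obtain ⟨Φl, hΦlc, hΦleq, hΦlbij, hΦlsph⟩ :=
    JordanDomain.exists_continuousOn_extension_holds R.toJordanDomain fl
  have hrado : TendstoUniformlyOn Φ Φl atTop (closedBall (0 : ℂ) 1) :=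
    JordanDomain.rado_tendstoUniformlyOn.closedBall JordanDomain.rado_tendstoUniformlyOn_holds
      (fun n ↦ (Q n).toJordanDomain) R.toJordanDomain f fl hf0 hfd hfld hJ Φ Φl hΦc hΦeq hΦlc hΦleq
  -- circle preimages of the corners
  have hcorner : ∀ n i, ∃ ζ ∈ sphere (0 : ℂ) 1, Φ n ζ = (Q n).pt i := fun n i ↦
    (hΦsph n).surjOn ((Q n).pt_mem_frontier i)
  choose ζ hζs hΦζ using hcorner
  have hcornerl : ∀ i, ∃ ζ ∈ sphere (0 : ℂ) 1, Φl ζ = R.pt i := fun i ↦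
    hΦlsph.surjOn (R.pt_mem_frontier i)
  choose ζl hζls hΦlζ using hcornerl
  have hζ : ∀ n i, ζ n i ∈ closedBall (0 : ℂ) 1 := fun n i ↦ sphere_subset_closedBall (hζs n i)
  have hζl : ∀ i, ζl i ∈ closedBall (0 : ℂ) 1 := fun i ↦ sphere_subset_closedBall (hζls i)
  -- the corner preimages converge, `ζ n i → ζl i`
  have hζlim : ∀ i, Tendsto (fun n ↦ ζ n i) atTop (𝓝 (ζl i)) := fun i ↦ by
    refine tendsto_of_injOn_of_tendsto_comp (isCompact_closedBall 0 1) hΦlc hΦlbij.injOn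
      (Eventually.of_forall fun n ↦ hζ n i) (hζl i) ?_
    rw [hΦlζ i]
    have h1 : Tendsto (fun n ↦ Φ n (ζ n i)) atTop (𝓝 (R.pt i)) :=
      (hpt i).congr fun n ↦ (hΦζ n i).symm
    refine h1.congr_dist ?_
    rw [Metric.tendsto_nhds]
    intro ε hε
    filter_upwards [Metric.tendstoUniformlyOn_iff.1 hrado ε hε] with n hn
    rw [Real.dist_eq, sub_zero, abs_of_nonneg dist_nonneg, dist_comm]
    exact hn (ζ n i) (hζ n i)
  -- the cross-ratios are the complex cross-ratios of the corner preimages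
  have hcr : ∀ n, (crossRatio (y n) : ℂ) = cCrossRatio (ζ n) := fun n ↦
    (Q n).ofReal_crossRatio_eq_cCrossRatio (f n) (hΦc n) (hΦeq n) (hΦbij n).injOn (hζ n)
      (hΦζ n) (hψ n)
  have hcrl : (crossRatio x : ℂ) = cCrossRatio ζl :=
    R.ofReal_crossRatio_eq_cCrossRatio fl hΦlc hΦleq hΦlbij.injOn hζl hΦlζ hφ
  -- the limit preimages are pairwise distinct, so the cross-ratio is continuous there
  have hζlinj : Function.Injective ζl := fun i j h ↦
    R.pt_injective (by rw [← hΦlζ i, ← hΦlζ j, h])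
  have hden : (ζl 0 - ζl 2) * (ζl 1 - ζl 3) ≠ 0 :=
    mul_ne_zero (sub_ne_zero.2 fun h ↦ by simpa using hζlinj h)
      (sub_ne_zero.2 fun h ↦ by simpa using hζlinj h)
  have hclim : Tendsto (fun n ↦ cCrossRatio (ζ n)) atTop (𝓝 (cCrossRatio ζl)) := by
    unfold cCrossRatio
    exact (((hζlim 0).sub (hζlim 1)).mul ((hζlim 2).sub (hζlim 3))).div
      (((hζlim 0).sub (hζlim 2)).mul ((hζlim 1).sub (hζlim 3))) hden
  -- take real parts
  have hre : (fun n ↦ crossRatio (y n)) = fun n ↦ (cCrossRatio (ζ n)).re := by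
    funext n
    rw [← hcr n, Complex.ofReal_re]
  have hrel : crossRatio x = (cCrossRatio ζl).re := by rw [← hcrl, Complex.ofReal_re]
  rw [hre, hrel]
  exact (Complex.continuous_re.tendsto _).comp hclim

/-- **The conformal modulus is continuous under uniform convergence of marked Jordan curves**
(corollary of Radó's theorem, Pommerenke (1992), §2.3 Thm. 2.11 with Cor. 2.4 and Thm. 2.6). If
the boundary loops of the conformal rectangles `Q n` converge uniformly, as parametrised loops,
to the boundary loop of `R`, and the marked points converge, `Q_n.pt i → R.pt i` (`i = 0, …, 3`),
then for ANY uniformizing data `(ψ n, y n)` of `Q n` and `(φ, x)` of `R` (conformal maps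
`ℍ → Q n`, `ℍ → R` with the marked points as boundary values at the real points `y n i`, `x i`)
the Cardy cross-ratios converge: `crossRatio (y n) → crossRatio x`. A point `z₀ ∈ R` lies in
`Q n` for large `n` (`JordanDomain.eventually_mem_carrier_of_tendstoUniformly`), and the tail of
the sequence is handled by `tendsto_crossRatio_of_tendstoUniformly_of_mem`.
[cite: PommerenkeBBCM1992, Thm. 2.11] -/
theorem tendsto_crossRatio_of_tendstoUniformly
    (hJ : TendstoUniformly (fun n ↦ (Q n).boundary) R.boundary atTop)
    (hpt : ∀ i, Tendsto (fun n ↦ (Q n).pt i) atTop (𝓝 (R.pt i)))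
    (ψ : ∀ n, ConformalEquiv upperHalfPlaneSet (Q n).carrier) (y : ℕ → Fin 4 → ℝ)
    (hψ : ∀ n, (Q n).IsUniformizing (ψ n) (y n))
    (φ : ConformalEquiv upperHalfPlaneSet R.carrier) (x : Fin 4 → ℝ) (hφ : R.IsUniformizing φ x) :
    Tendsto (fun n ↦ crossRatio (y n)) atTop (𝓝 (crossRatio x)) := by
  obtain ⟨z₀, hz₀⟩ := R.nonempty
  obtain ⟨N₀, hN₀⟩ := eventually_atTop.1
    (JordanDomain.eventually_mem_carrier_of_tendstoUniformly
      (D := fun n ↦ (Q n).toJordanDomain) hJ hz₀)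
  have hJ' : TendstoUniformly (fun n ↦ (Q (n + N₀)).boundary) R.boundary atTop := by
    rw [Metric.tendstoUniformly_iff] at hJ ⊢
    exact fun ε hε ↦ (tendsto_add_atTop_nat N₀).eventually (hJ ε hε)
  have h := tendsto_crossRatio_of_tendstoUniformly_of_mem (Q := fun n ↦ Q (n + N₀)) hJ'
    (fun i ↦ (hpt i).comp (tendsto_add_atTop_nat N₀)) hz₀
    (fun n ↦ hN₀ (n + N₀) (Nat.le_add_left _ _)) (ψ := fun n ↦ ψ (n + N₀))
    (y := fun n ↦ y (n + N₀)) (fun n ↦ hψ (n + N₀)) hφ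
  exact (tendsto_add_atTop_iff_nat N₀).1 h

/-- **The conformal modulus is continuous under uniform convergence of marked Jordan curves,
mark-parameter form.** As `tendsto_crossRatio_of_tendstoUniformly`, with the convergence of the
marked points replaced by that of the mark parameters, `Q_n.mark i → R.mark i` (which implies it,
`MarkedDomain.tendsto_pt_of_tendstoUniformly`). Pommerenke (1992), §2.3, Thm. 2.11 and Cor. 2.4.
[cite: PommerenkeBBCM1992, Thm. 2.11] -/
theorem tendsto_crossRatio_of_tendsto_mark
    (hJ : TendstoUniformly (fun n ↦ (Q n).boundary) R.boundary atTop)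
    (hm : ∀ i, Tendsto (fun n ↦ (Q n).mark i) atTop (𝓝 (R.mark i)))
    (ψ : ∀ n, ConformalEquiv upperHalfPlaneSet (Q n).carrier) (y : ℕ → Fin 4 → ℝ)
    (hψ : ∀ n, (Q n).IsUniformizing (ψ n) (y n))
    (φ : ConformalEquiv upperHalfPlaneSet R.carrier) (x : Fin 4 → ℝ) (hφ : R.IsUniformizing φ x) :
    Tendsto (fun n ↦ crossRatio (y n)) atTop (𝓝 (crossRatio x)) :=
  tendsto_crossRatio_of_tendstoUniformly hJ
    (fun _ ↦ MarkedDomain.tendsto_pt_of_tendstoUniformly hJ (hm _)) ψ y hψ φ x hφ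

end ConformalRectangle

end Literature.Probability.RandomPlanarGeometry
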